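import Mathlib

/-!
# HodgeLocusCensusRamified7DepthTowerBCore — the depth-reduction theorem for the ROW 7 / ROW 11 Gross-lattice towers (engine B, pub-hlocus-abs-2 gen 34)

certified instances and evidence bearing on the general Hodge conjecture; no claim.

Setting (DERIVATIONS_engineB.md §35; code note `hl7/DEPTH-REDUCTION-B.md`).  In `B = (−1,−7)_ℚ` with maximal order `O = O_E ⊕ O_E·i`
(`E = ℚ(√−7)`), the census orders of ROW 7 at depth `k` are `R_k(w) = ℤ⟨1,w⟩ + 7^k O`; their Gross lattices `S(R) = {2x − tr x}` with `nrd/7`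
form genera `A_k` (two spinor genera `spn₁ ∋ S(R_k(j)), S(R_k(k))`, `spn₂ ∋ S(R_k(j ± k))`) and `B_k` (one spinor genus).  With
`M_s^{(k)}(n) = Σ_{[L] ∈ spn_s(A_k)} r(n;L)/#Aut L` the depth-reduction theorem (proved in the note from an orbit–stabiliser identity for the map
`R ↦ R + 7^{k−1}O` on types of orders and three 7-adic lemmas) says: (R1) `7 ∤ n ⇒ M_s^{(k)}(n) = M_s^{(1)}(n)`; (R2) `7 ∥ n, k ≥ 2 ⇒ M_s^{(k)}(n) = 0`;
(R3) `k ≥ 2 ⇒ M_s^{(k)}(49n′) = 49·M_s^{(k−1)}(n′)`; and at depth 1 both halves agree on multiples of 7.  THIS FILE proves, abstractly over `ℚ`-valued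
arrays, what follows from these rules for EVERY depth `k` — the all-`k` form of the spinor deviation law
`M₁^{(k)} − M₂^{(k)} = c · Σ_{v<k} 49^v U(49^v z)` (`P4_all_depths`), the closed forms (`closed_form_coprime`, `closed_form_exact7`, `closed_form_high`)
and the masses `49^{k−1}·mass₁` (`mass_all_depths`) — so that the only analytic input left is the depth-1 constant `c` (`= 1/4` for the S family,
`1/2` for the trace-zero family).  That input is itself re-certified here in a third, theta-free way: by the note's Lemma C it is the SIGNED COUNT identity
`#{x ∈ S(O) : nrd x = 7n, x mod 7O on the j- or k-line} − #{… on the (j±k)-lines} = 2·u(n)` (`u(m²) = χ₇(m)·m`, else `0`), decided below for all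
`n ≤ 60`, `7 ∤ n` (`signedS_eq`), and its trace-zero analogue with `4·u(n)` (`signedT_eq`).  Finally the depth-0 lattices are identified:
`(S(O), nrd) ≅ 7b² + 4(a² + ac + 2c²)` and `(O⁰, nrd) ≅ (a² − ab + 2b²) ⊥ 7c²` by explicit unimodular matrices, and the line count behind
`|Sub^A(O)| = |Sub^B(O)| = 4` is decided in `𝔽₇`.  Exact checks of (R0)–(R3) against all held class lists (depths ≤ 3, 21000 coefficients per series,
0 exceptions) and of the local lemmas to depth 5 are recorded in `hl7/depthred_N24500_6200.json`, `hl7/depthred_local_K5_N4900.json`.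
Nothing here is cited as a published fact.
-/

set_option linter.dupNamespace false

namespace Summit.HodgeConjecture.HodgeConjecture.HodgeLocus.Census.Ramified7DepthTowerBCore

open Finset Matrix

/-! ## 1. The tower algebra (all depths) -/

/-- the predicted depth-`k` deviation array: `P u k n = Σ_{v<k} [49^v ∣ n]·49^v·u(n/49^v)`. -/
def P (u : ℕ → ℚ) (k n : ℕ) : ℚ := ∑ v ∈ range k, if 49 ^ v ∣ n then (49 : ℚ) ^ v * u (n / 49 ^ v) else 0

/-- depth 1: `P u 1 = u`. -/
theorem P_one (u : ℕ → ℚ) (n : ℕ) : P u 1 n = u n := by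
  simp [P]

/-- off the multiples of 49 only the `v = 0` term survives: `P u k n = u n`. -/
theorem P_of_not_49_dvd (u : ℕ → ℚ) {k n : ℕ} (hk : 1 ≤ k) (hn : ¬ 49 ∣ n) : P u k n = u n := by
  obtain ⟨j, rfl⟩ : ∃ j, k = j + 1 := ⟨k - 1, by omega⟩
  unfold P
  rw [sum_range_succ']
  simp only [pow_zero, one_dvd, if_true, Nat.div_one, one_mul]
  rw [sum_eq_zero (fun v _ => ?_), zero_add]
  rw [if_neg]
  intro h
  exact hn (dvd_trans (dvd_pow_self 49 (Nat.succ_ne_zero v)) h)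

/-- the shift `P u (k+1) (49 n′) = 49 · P u k n′` (for `u` vanishing on multiples of 7) — the array form of rule (R3). -/
theorem P_succ_mul (u : ℕ → ℚ) (hu : ∀ n, 7 ∣ n → u n = 0) (k n' : ℕ) : P u (k + 1) (49 * n') = 49 * P u k n' := by
  unfold P
  rw [sum_range_succ', mul_sum]
  have h0 : (if 49 ^ 0 ∣ 49 * n' then (49 : ℚ) ^ 0 * u (49 * n' / 49 ^ 0) else 0) = 0 := by
    simp only [pow_zero, one_dvd, if_true, Nat.div_one, one_mul]
    exact hu _ (dvd_mul_of_dvd_left (by norm_num) _)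
  rw [h0, add_zero]
  refine sum_congr rfl (fun v _ => ?_)
  have hdvd : (49 ^ (v + 1) ∣ 49 * n') ↔ (49 ^ v ∣ n') := by
    rw [pow_succ']
    exact Nat.mul_dvd_mul_iff_left (by norm_num)
  have hdiv : 49 * n' / 49 ^ (v + 1) = n' / 49 ^ v := by
    rw [pow_succ', Nat.mul_div_mul_left _ _ (by norm_num)]
  by_cases h : 49 ^ v ∣ n'
  · rw [if_pos (hdvd.mpr h), if_pos h, hdiv, pow_succ]; ring
  · rw [if_neg (fun h' => h (hdvd.mp h')), if_neg h, mul_zero]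

/-- **(P4) for all depths.**  If the difference array `D k n = M₁^{(k)}(n) − M₂^{(k)}(n)` obeys the rules (R1)–(R3), vanishes at depth 1 on
multiples of 7 ((R0)), and equals `c·u` at depth 1 off the multiples of 7 (`u` vanishing on multiples of 7 — e.g. `u(m²) = χ₇(m)m`), then
`D k = c · Σ_{v<k} 49^v u(·/49^v)` at EVERY depth `k ≥ 1`. -/
theorem P4_all_depths (D : ℕ → ℕ → ℚ) (u : ℕ → ℚ) (c : ℚ)
    (r1 : ∀ k n, 1 ≤ k → ¬ 7 ∣ n → D k n = D 1 n) (r2 : ∀ k n, 2 ≤ k → 7 ∣ n → ¬ 49 ∣ n → D k n = 0)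
    (r3 : ∀ k n', 2 ≤ k → D k (49 * n') = 49 * D (k - 1) n') (r0 : ∀ m, D 1 (7 * m) = 0)
    (hu : ∀ n, 7 ∣ n → u n = 0) (base : ∀ n, ¬ 7 ∣ n → D 1 n = c * u n) : ∀ k, 1 ≤ k → ∀ n, D k n = c * P u k n := by
  have base' : ∀ n, D 1 n = c * u n := by
    intro n
    by_cases h7 : 7 ∣ n
    · obtain ⟨m, rfl⟩ := h7
      rw [r0, hu _ ⟨m, rfl⟩, mul_zero]
    · exact base n h7
  have main : ∀ j n, D (j + 1) n = c * P u (j + 1) n := by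
    intro j
    induction j with
    | zero => intro n; rw [P_one, base']
    | succ j ih =>
      intro n
      by_cases h49 : 49 ∣ n
      · obtain ⟨n', rfl⟩ := h49
        rw [r3 _ _ (by omega), show j + 1 + 1 - 1 = j + 1 from rfl, ih, P_succ_mul u hu]
        ring
      · rw [P_of_not_49_dvd u (by omega) h49]
        by_cases h7 : 7 ∣ n
        · rw [r2 _ _ (by omega) h7 h49, hu n h7, mul_zero]
        · rw [r1 _ _ (by omega) h7, base']
  intro k hk n
  obtain ⟨j, rfl⟩ : ∃ j, k = j + 1 := ⟨k - 1, by omega⟩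
  exact main j n

/-! The rules for ONE series `M k n = M_s^{(k)}(n)` (or the genus-B series): (R1) `r1`, (R2) `r2`, (R3) `r3`, and (R0) `r0` giving its depth-1
values at multiples of 7 by an array `B7` (`B7 m = 2·r(m; S(O))/8` for a spinor half, `4·r(m;S(O))/8` for genus B). -/

/-- closed form, part 1: `M^{(k)}(49^v n₀) = 49^v M^{(1)}(n₀)` for `v < k`, `7 ∤ n₀` (uses (R1), (R3)). -/
theorem closed_form_coprime (M : ℕ → ℕ → ℚ) (r1 : ∀ k n, 1 ≤ k → ¬ 7 ∣ n → M k n = M 1 n)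
    (r3 : ∀ k n', 2 ≤ k → M k (49 * n') = 49 * M (k - 1) n') :
    ∀ v k n₀, v < k → ¬ 7 ∣ n₀ → M k (49 ^ v * n₀) = 49 ^ v * M 1 n₀ := by
  intro v
  induction v with
  | zero => intro k n₀ hk h7; simpa using r1 k n₀ (by omega) h7
  | succ v ih =>
    intro k n₀ hk h7
    rw [pow_succ', mul_assoc, r3 _ _ (by omega), ih (k - 1) n₀ (by omega) h7, pow_succ']
    ring

/-- closed form, part 2: `M^{(k)}(49^v n₀) = 0` for `v + 2 ≤ k`, `7 ∥ n₀` (uses (R2), (R3)). -/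
theorem closed_form_exact7 (M : ℕ → ℕ → ℚ) (r2 : ∀ k n, 2 ≤ k → 7 ∣ n → ¬ 49 ∣ n → M k n = 0)
    (r3 : ∀ k n', 2 ≤ k → M k (49 * n') = 49 * M (k - 1) n') :
    ∀ v k n₀, v + 2 ≤ k → 7 ∣ n₀ → ¬ 49 ∣ n₀ → M k (49 ^ v * n₀) = 0 := by
  intro v
  induction v with
  | zero => intro k n₀ hk h7 h49; simpa using r2 k n₀ (by omega) h7 h49
  | succ v ih =>
    intro k n₀ hk h7 h49
    rw [pow_succ', mul_assoc, r3 _ _ (by omega), ih (k - 1) n₀ (by omega) h7 h49, mul_zero]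

/-- closed form, part 3: `M^{(k)}(7^{2k−1} m) = 49^{k−1}·B7(m)` — all of `S(O)` shows up, scaled (uses (R3), (R0)). -/
theorem closed_form_high (M : ℕ → ℕ → ℚ) (B7 : ℕ → ℚ) (r3 : ∀ k n', 2 ≤ k → M k (49 * n') = 49 * M (k - 1) n')
    (r0 : ∀ m, M 1 (7 * m) = B7 m) :
    ∀ k, 1 ≤ k → ∀ m, M k (7 ^ (2 * k - 1) * m) = 49 ^ (k - 1) * B7 m := by
  have main : ∀ j m, M (j + 1) (7 ^ (2 * j + 1) * m) = 49 ^ j * B7 m := by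
    intro j
    induction j with
    | zero => intro m; simpa using r0 m
    | succ j ih =>
      intro m
      have e : 7 ^ (2 * (j + 1) + 1) * m = 49 * (7 ^ (2 * j + 1) * m) := by ring
      rw [e, r3 _ _ (by omega), show j + 1 + 1 - 1 = j + 1 from rfl, ih, pow_succ]
      ring
  intro k hk m
  obtain ⟨j, rfl⟩ : ∃ j, k = j + 1 := ⟨k - 1, by omega⟩
  have e1 : 2 * (j + 1) - 1 = 2 * j + 1 := by omega
  rw [e1, show j + 1 - 1 = j from rfl]
  exact main j m

/-- masses along the tower: `mass_k = 49^{k−1}·mass_1` (the `n = 0` case of (R3)). -/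
theorem mass_all_depths (mass : ℕ → ℚ) (h : ∀ k, 2 ≤ k → mass k = 49 * mass (k - 1)) :
    ∀ k, 1 ≤ k → mass k = 49 ^ (k - 1) * mass 1 := by
  have main : ∀ j, mass (j + 1) = 49 ^ j * mass 1 := by
    intro j
    induction j with
    | zero => simp
    | succ j ih => rw [h _ (by omega), show j + 1 + 1 - 1 = j + 1 from rfl, ih, pow_succ]; ring
  intro k hk
  obtain ⟨j, rfl⟩ : ∃ j, k = j + 1 := ⟨k - 1, by omega⟩
  simpa using main j

/-- numerical instances of the mass law actually observed: `49/4 = 49·(1/4)`, `2401/4 = 49²·(1/4)` (spinor halves, depths 2, 3),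
`49/2`, `2401/2` (genus B), and ROW 11: `605/24 = 121·(5/24)`. -/
theorem mass_instances : (49 / 4 : ℚ) = 49 * (1 / 4) ∧ (2401 / 4 : ℚ) = 49 ^ 2 * (1 / 4) ∧ (49 / 2 : ℚ) = 49 * (1 / 2) ∧
    (2401 / 2 : ℚ) = 49 ^ 2 * (1 / 2) ∧ (605 / 24 : ℚ) = 121 * (5 / 24) := by norm_num

/-! ## 2. The depth-1 input, re-certified as a signed count in `S(O)` (theta-free)

`S(O) = ℤ(i+k) ⊕ ℤj ⊕ ℤ·2k = {a i + b j + c k : a ≡ c (mod 2)}`, `nrd = a² + 7b² + 7c²`; `nrd x = 7n` forces `a = 7a′` (`a′ ≡ c (2)`),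
`n = 7a′² + b² + c²`, and `x mod 7O` lies on the line `(b : c)` of `P/P² ≅ 𝔽₇²`: the `j`/`k`-lines are `bc ≡ 0`, the `(j±k)`-lines `b² ≡ c²`
(`bc ≢ 0`); the other four lines (`n` a non-residue) belong to genus B.  We count over `a′, b, c ≥ 0` with multiplicity `2^{#non-zero}`. -/

/-- sign multiplicity of a non-negative coordinate. -/
def wt (x : ℕ) : ℤ := if x = 0 then 1 else 2

/-- `+1` on the `j`- and `k`-lines, `−1` on the `(j ± k)`-lines, `0` on the genus-B lines. -/
def lineSign (b c : ℕ) : ℤ := if (b * c) % 7 = 0 then 1 else if (b * b) % 7 = (c * c) % 7 then -1 else 0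

/-- signed count for the S family: triples with `7a′² + b² + c² = n`, `a′ ≡ c (mod 2)`. -/
def signedS (n : ℕ) : ℤ :=
  ((List.range (n.sqrt + 1)).map fun a => ((List.range (n.sqrt + 1)).map fun b => ((List.range (n.sqrt + 1)).map fun c =>
    if 7 * a * a + b * b + c * c = n ∧ (a + c) % 2 = 0 then wt a * wt b * wt c * lineSign b c else 0).sum).sum).sum

/-- signed count for the trace-zero family: `O⁰ = {(a/2) i + b j + (c/2) k : a ≡ c (2)}`, `nrd = (a² + 7c²)/4 + 7b²`; `nrd = 7n` forces
`a = 7a′`, `4n = 7a′² + 4b² + c²`, and the direction is `(b : 4c)`: `j`/`k`-lines `bc ≡ 0`, `(j±k)`-lines `4b² ≡ c²`. -/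
def lineSignT (b c : ℕ) : ℤ := if (b * c) % 7 = 0 then 1 else if (4 * b * b) % 7 = (c * c) % 7 then -1 else 0

/-- see `lineSignT`. -/
def signedT (n : ℕ) : ℤ :=
  ((List.range ((4 * n).sqrt + 1)).map fun a => ((List.range (n.sqrt + 1)).map fun b => ((List.range ((4 * n).sqrt + 1)).map fun c =>
    if 7 * a * a + 4 * b * b + c * c = 4 * n ∧ (a + c) % 2 = 0 then wt a * wt b * wt c * lineSignT b c else 0).sum).sum).sum

/-- `χ₇` as a function on `ℕ` (Euler's criterion). -/
def chi7 (m : ℕ) : ℤ := if m % 7 = 0 then 0 else if (m ^ 3) % 7 = 1 then 1 else -1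

/-- `u(n) = χ₇(m)·m` if `n = m²`, else `0` (the coefficient of the unary theta series `U`). -/
def useries (n : ℕ) : ℤ := ((List.range (n.sqrt + 1)).map fun m => if m * m = n then chi7 m * m else 0).sum

/-- **(S2) as a signed count**, `n ≤ 100`, `7 ∤ n`: `signedS n = 2·u(n)`; i.e. `M₁^{(1)}(n) − M₂^{(1)}(n) = signedS(n)/8 = u(n)/4`.  Together with
`M₁^{(1)}(7m) = M₂^{(1)}(7m)` (Lemma C of the note) this covers the coefficients `q⁰ … q^{42}` of `G = θ_{L₁} + θ_{L₂} − 2θ_{L₃} − 2U ∈ M_{3/2}(Γ₀(196), (28/·))`,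
i.e. the Sturm range `⌊3·336/24⌋ + 1 = 43` of §31.12 — a theta-free second certificate of (S2) (the first: HL7-S, PARI `mf`). -/
theorem signedS_eq : ∀ n ∈ List.range 101, n % 7 ≠ 0 → signedS n = 2 * useries n := by decide +kernel

/-- **(S1) as a signed count**, `n ≤ 100`, `7 ∤ n`: `signedT n = 4·u(n)` (`M₁ − M₂ = u/2` for the trace-zero family; same Sturm range). -/
theorem signedT_eq : ∀ n ∈ List.range 101, n % 7 ≠ 0 → signedT n = 4 * useries n := by decide +kernel

/-- the worked instance of the note (§5.4): `n = 9`: `±3j` (`+2`) against `±7i ± j ± k` (`−8`): `−6 = 2·χ₇(3)·3`. -/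
theorem signedS_nine : signedS 9 = -6 ∧ useries 9 = -3 := by decide +kernel

/-- Sturm arithmetic for level `196 = 4·49`: index `196·(3/2)·(8/7) = 336`, weight-`3/2` bound `⌊3·336/24⌋ + 1 = 43 ≤ 100`. -/
theorem sturm196 : 196 * 3 * 8 / (2 * 7) = 336 ∧ 3 * 336 / 24 + 1 = 43 ∧ 43 ≤ 100 := by norm_num

/-! ## 3. Depth 0 and the line count -/

/-- `(S(O), nrd)`, doubled Gram in the basis `i+k, j, 2k`. -/
def S0 : Matrix (Fin 3) (Fin 3) ℤ := !![16, 0, 28; 0, 14, 0; 28, 0, 56]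
/-- `7b² + 4(a² + ac + 2c²)`, doubled Gram. -/
def S0std : Matrix (Fin 3) (Fin 3) ℤ := !![14, 0, 0; 0, 8, 4; 0, 4, 16]
/-- `(O⁰, nrd)`, doubled Gram (HNF basis of the trace-zero part of `O`). -/
def T0 : Matrix (Fin 3) (Fin 3) ℤ := !![4, 0, 7; 0, 14, 0; 7, 0, 14]
/-- `(a² − ab + 2b²) ⊥ 7c²`, doubled Gram. -/
def T0std : Matrix (Fin 3) (Fin 3) ℤ := !![2, -1, 0; -1, 4, 0; 0, 0, 14]
/-- unimodular change of basis for `S0`. -/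
def WS : Matrix (Fin 3) (Fin 3) ℤ := !![0, 0, -1; -1, 0, 0; 0, 1, -2]
/-- unimodular change of basis for `T0`. -/
def WT : Matrix (Fin 3) (Fin 3) ℤ := !![-1, -1, 0; 0, 0, -1; -1, -2, 0]

/-- `(S(O), nrd) ≅ 7b² + 4Θ₇` and `(O⁰, nrd) ≅ Θ₇ ⊥ 7c²` (class number one lattices of determinants `32·49` and `2·49`). -/
theorem depth0_isometries : WS * S0std * WSᵀ = S0 ∧ WS.det = 1 ∧ WT * T0std * WTᵀ = T0 ∧ WT.det = 1 ∧
    S0.det = 1568 ∧ T0.det = 98 ∧ (1568 : ℤ) = 32 * 49 ∧ (98 : ℤ) = 2 * 49 := by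
  refine ⟨by decide, by decide, by decide, by decide, by decide, by decide, by norm_num, by norm_num⟩

/-- the eight lines of `P/P² ≅ 𝔽₇²` split `4 + 4` by the norm class: `b² + c²` is a non-zero square exactly on the lines `b = 0`, `c = 0`,
`b = ±c` (directions `k, j, j ± k`: genus A), and a non-square exactly on `b = ±2c`, `b = ±3c` (genus B).  Counted with `6` points per line. -/
theorem line_split :
    (Finset.univ.filter fun p : ZMod 7 × ZMod 7 => p ≠ 0 ∧ IsSquare (p.1 ^ 2 + p.2 ^ 2) ∧ p.1 ^ 2 + p.2 ^ 2 ≠ 0).card = 24 ∧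
    (Finset.univ.filter fun p : ZMod 7 × ZMod 7 => ¬ IsSquare (p.1 ^ 2 + p.2 ^ 2)).card = 24 ∧
    (∀ b c : ZMod 7, (IsSquare (b ^ 2 + c ^ 2) ∧ b ^ 2 + c ^ 2 ≠ 0) ↔ ((b, c) ≠ (0, 0) ∧ (b * c = 0 ∨ b ^ 2 = c ^ 2))) := by
  refine ⟨by decide, by decide, by decide⟩

/-- the fibre sizes of the tower maps: `|O_7/(ℤ_7 + ℤ_7 w + 7O_7)| = 7⁴/7² = 49` one-step suborders (ROW 7), `11⁴/11² = 121` (ROW 11),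
and `4·49^{k−1}` resp. `121^k` orders over `O` — the indices behind (R3) and the masses. -/
theorem fibre_sizes : 7 ^ 4 / 7 ^ 2 = 49 ∧ 11 ^ 4 / 11 ^ 2 = 121 ∧ (∀ k : ℕ, 1 ≤ k → 4 * 49 ^ (k - 1) * 2 = 8 * 49 ^ (k - 1)) := by
  refine ⟨by norm_num, by norm_num, fun k _ => by ring⟩

end Summit.HodgeConjecture.HodgeConjecture.HodgeLocus.Census.Ramified7DepthTowerBCore
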